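import Summits.Ventures.PercRepro.Night2LocalDQFive

/-!
# PercRepro — the regime `|E ∖ G| = 3` at `q = 4` on COLOOP-FREE flats: the counting half (night-2, gen 12)

The `(6, 4)` shadow row is open exactly at the rank-`5` flats `G` with `|E ∖ G| ∈ {2, 3}` of loopless simple
rank-`6` matroids (`shadowHall_six_four_of_local_two_three`).  This file starts the regime `d = |E ∖ G| = 3`
for the flats whose restriction `M|G` has NO coloop (`kColoops G = 0`) with the distance-2 rule
(`localShadowHall_of_distance_two`):

* without coloops of `M|G` there is no layer-0 member (`kColoops_pos_of_mem_lay0`), so `capS = 1` everywhere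
  (`capS_eq_one_of_kColoops_eq_zero`);
* at `d = 3` every member outside layer 0 requests at most `Φ/5 = 6/25` (`req_le_of_not_lay0`, any `d ≤ q`), a
  shadow set has at most `5` covering preimages, so `L1 ≤ 6/5` and the served fraction is at least `5/6`
  (`one_sub_fS_le_sixth`); every loss is `≤ 1/25` and every layer-2 weight `≤ 2/25` (`w2_le_d3_zero`);
* the residual capacity at a set with `a` coloops is `≥ 1 − 6a/25` (`cap2_ge_d3_zero`), and the pair count
  `2·#ex2 ≤ (6−a)(5−a)` closes the column condition for `a ≥ 2` (`load2_le_cap2_d3_zero_of_two_le`): `a = 3`: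
  `3·(2/25) ≤ 7/25`; `a = 2`: `6·(2/25) ≤ 13/25`; `a = 4`: no layer-2 weight (simple); `a ≥ 5`: no series pair.

The sets with `a ≤ 1` coloops need the fat-pair count of the sequel (`Night2LocalD3ZeroFat`).
Paper: `proofs/NIGHT-2-dq3.md` §1–§3.
-/

open scoped Matroid

namespace PercRepro.Shadow

open Finset PerFlat ThmH

variable {α : Type*} [DecidableEq α] {M : Matroid α} [M.Finite]

section General

variable {q : ℕ} {G : Finset α}

omit [DecidableEq α] in
/-- `clF` is idempotent. -/
theorem clF_clF_self (X : Finset α) : clF M (clF M X) = clF M X := by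
  rw [← Finset.coe_inj, coe_clF, coe_clF, M.closure_closure]

open scoped Classical in
/-- A layer-0 member `B` has `G ∖ cl B = {y}` with `cl B = G ∖ y`, so `y` is a coloop of `M|G`:
`kColoops G ≥ 1`. -/
theorem kColoops_pos_of_mem_lay0 {B : Finset α} (hB : B ∈ lay0 M q G) : 1 ≤ kColoops M G := by
  rw [mem_lay0] at hB
  obtain ⟨hBm, hcard, -⟩ := hB
  obtain ⟨y, hy⟩ := Finset.card_eq_one.1 hcard
  have hymem : y ∈ G \ clF M B := by rw [hy]; exact Finset.mem_singleton_self y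
  have hyG : y ∈ G := (Finset.mem_sdiff.1 hymem).1
  have hycl : y ∉ clF M B := (Finset.mem_sdiff.1 hymem).2
  have hBG : clF M B ⊆ G := (mem_membersIn.1 hBm).2
  have hclB : clF M B = G.erase y := by
    ext e
    constructor
    · intro he
      rw [Finset.mem_erase]
      refine ⟨?_, hBG he⟩
      rintro rfl
      exact hycl he
    · intro he
      rw [Finset.mem_erase] at he
      by_contra hne
      have : e ∈ G \ clF M B := Finset.mem_sdiff.2 ⟨he.2, hne⟩
      rw [hy, Finset.mem_singleton] at this
      exact he.1 this
  unfold kColoops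
  apply Finset.card_pos.2
  refine ⟨y, Finset.mem_filter.2 ⟨hyG, ?_⟩⟩
  rw [← hclB, clF_clF_self]
  exact hycl

open scoped Classical in
/-- Without coloops of `M|G` there is no layer-0 member. -/
theorem lay0_eq_empty_of_kColoops_eq_zero (hk : kColoops M G = 0) : lay0 M q G = ∅ := by
  rw [Finset.eq_empty_iff_forall_notMem]
  intro B hB
  have := kColoops_pos_of_mem_lay0 hB
  omega

open scoped Classical in
/-- Without coloops of `M|G`, `k1 S = 0` at every set. -/
theorem k1_eq_zero_of_kColoops_eq_zero (hk : kColoops M G = 0) (S : Finset α) : k1 M q G S = 0 := by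
  unfold k1
  rw [Finset.card_eq_zero, Finset.filter_eq_empty_iff]
  intro B _ hB
  rw [lay0_eq_empty_of_kColoops_eq_zero hk] at hB
  exact Finset.notMem_empty B hB

/-- Without coloops of `M|G`, `capS S = 1` at every set. -/
theorem capS_eq_one_of_kColoops_eq_zero (hk : kColoops M G = 0) (S : Finset α) : capS M q G S = 1 := by
  unfold capS
  rw [k1_eq_zero_of_kColoops_eq_zero hk]
  simp

open scoped Classical in
/-- At `|E ∖ G| = d ≤ q` a member outside layer 0 has `|G ∖ cl B| ≥ 2`, hence requests at most `Φ/(2 + d)`. -/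
theorem req_le_of_not_lay0 (hG : G ∈ flatsQ M (q + 1)) {d : ℕ} (hd : (gr M \ G).card = d) (hdq : d ≤ q)
    {B : Finset α} (hB : B ∈ membersIn M (Uq M (q + 2) q) G) (hB0 : B ∉ lay0 M q G) :
    req M q B ≤ phiQ q / (2 + (d : ℚ)) := by
  have hm := two_le_card_sdiff_of_not_lay0 hG (hd ▸ hdq) hB hB0
  have hBG : clF M B ⊆ G := (mem_membersIn.1 hB).2
  have hc : (gr M \ clF M B).card = (G \ clF M B).card + d := by rw [card_compl_clF_add hG hBG, hd]
  unfold req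
  apply div_le_div_of_nonneg_left (phiQ_pos q).le (by positivity)
  rw [hc]; push_cast
  have : (2 : ℚ) ≤ ((G \ clF M B).card : ℚ) := by exact_mod_cast hm
  linarith

open scoped Classical in
/-- `L1 S ≤ #(non-layer-0 preimages) · Φ/(2 + d)` at `|E ∖ G| = d ≤ q`. -/
theorem L1_le_card_mul (hG : G ∈ flatsQ M (q + 1)) {d : ℕ} (hd : (gr M \ G).card = d) (hdq : d ≤ q)
    (S : Finset α) :
    L1 M q G S ≤ (((coverPreimages M (Uq M (q + 2) q) G S).filter (fun B => B ∉ lay0 M q G)).card : ℚ) *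
      (phiQ q / (2 + (d : ℚ))) := by
  unfold L1
  have hle : ∀ B ∈ (coverPreimages M (Uq M (q + 2) q) G S).filter (fun B => B ∉ lay0 M q G),
      req M q B ≤ phiQ q / (2 + (d : ℚ)) := by
    intro B hB
    rw [Finset.mem_filter, mem_coverPreimages] at hB
    exact req_le_of_not_lay0 hG hd hdq hB.1.1 hB.2
  refine (Finset.sum_le_sum hle).trans ?_
  rw [Finset.sum_const, nsmul_eq_mul]

open scoped Classical in
/-- `L1 S ≤ #coloops(S) · Φ/(2 + d)` at `|E ∖ G| = d ≤ q`. -/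
theorem L1_le_coloops_mul (hG : G ∈ flatsQ M (q + 1)) {d : ℕ} (hd : (gr M \ G).card = d) (hdq : d ≤ q)
    (S : Finset α) : L1 M q G S ≤ ((coloops M S).card : ℚ) * (phiQ q / (2 + (d : ℚ))) := by
  refine (L1_le_card_mul hG hd hdq S).trans ?_
  apply mul_le_mul_of_nonneg_right _ (div_nonneg (phiQ_pos q).le (by positivity))
  have h1 : ((coverPreimages M (Uq M (q + 2) q) G S).filter (fun B => B ∉ lay0 M q G)).card ≤
      (coloops M S).card :=
    (Finset.card_filter_le _ _).trans (card_coverPreimages_le_card_coloops (Finset.Subset.refl _) G S)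
  exact_mod_cast h1

open scoped Classical in
/-- `L1 S ≤ (q + 1) · Φ/(2 + d)` at every shadow set, `|E ∖ G| = d ≤ q`. -/
theorem L1_le_shadow_mul (hG : G ∈ flatsQ M (q + 1)) {d : ℕ} (hd : (gr M \ G).card = d) (hdq : d ≤ q)
    {S : Finset α} (hS : S ∈ shadowAt M (q + 2) q (Uq M (q + 2) q) G) :
    L1 M q G S ≤ ((q : ℚ) + 1) * (phiQ q / (2 + (d : ℚ))) := by
  refine (L1_le_card_mul hG hd hdq S).trans ?_
  apply mul_le_mul_of_nonneg_right _ (div_nonneg (phiQ_pos q).le (by positivity))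
  have h1 : ((coverPreimages M (Uq M (q + 2) q) G S).filter (fun B => B ∉ lay0 M q G)).card ≤ q + 1 :=
    (Finset.card_filter_le _ _).trans (card_coverPreimages_le (Finset.Subset.refl _) hS)
  exact_mod_cast h1

/-- `1 − fS S ≤ (L − 1)/L` whenever `capS S = 1` and `L1 S ≤ L` with `1 ≤ L`. -/
theorem one_sub_fS_le_of_capS_eq_one {S : Finset α} (hcap : capS M q G S = 1) {L : ℚ} (hL1 : L1 M q G S ≤ L)
    (hL : 1 ≤ L) : 1 - fS M q G S ≤ (L - 1) / L := by
  have hLpos : 0 < L := by linarith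
  have hrhs : 0 ≤ (L - 1) / L := div_nonneg (by linarith) hLpos.le
  unfold fS
  rw [hcap]
  split_ifs with hle
  · rw [sub_self]; exact hrhs
  · push Not at hle
    have hpos : 0 < L1 M q G S := by linarith
    have h1 : 1 - 1 / L1 M q G S = (L1 M q G S - 1) / L1 M q G S := by field_simp
    rw [h1]
    exact ratio_mono zero_le_one hpos hL1

/-- The residual capacity is at least `capS − L1`. -/
theorem cap2_ge_capS_sub_L1 {S : Finset α} (hcap : 0 ≤ capS M q G S) :
    capS M q G S - L1 M q G S ≤ cap2 M q G S := by
  unfold cap2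
  have h1 := fS_le_one (M := M) (q := q) (G := G) (S := S) hcap
  have h2 := L1_nonneg (M := M) q G S
  nlinarith

open scoped Classical in
/-- `load2 S ≤ #ex2 S · c` whenever every member carrying layer-2 weight at `S` has `w2 ≤ c`. -/
theorem load2_le_card_ex2_mul {S : Finset α} {c : ℚ} (hw : ∀ B ∈ ex2 M q G S, w2 M q G B S ≤ c) :
    load2 M q G S ≤ ((ex2 M q G S).card : ℚ) * c := by
  unfold load2
  rw [← Finset.sum_filter_ne_zero]
  have : ∀ B ∈ (membersIn M (Uq M (q + 2) q) G).filter (fun B => w2 M q G B S ≠ 0), w2 M q G B S ≤ c :=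
    fun B hB => hw B hB
  refine (Finset.sum_le_sum this).trans ?_
  rw [Finset.sum_const, nsmul_eq_mul]
  unfold ex2
  exact le_refl _

end General

section DThree

variable {G S : Finset α}

omit [DecidableEq α] [M.Finite] in
/-- `Φ(4)/(2 + 3) = 6/25`. -/
theorem phiQ_four_div_five : phiQ 4 / (2 + ((3 : ℕ) : ℚ)) = 6 / 25 := by
  unfold phiQ; norm_num

open scoped Classical in
/-- At `d = 3`, `q = 4`, without coloops of `M|G`: `L1 S ≤ 6/5` at every shadow set. -/
theorem L1_le_six_fifths (hG : G ∈ flatsQ M (4 + 1)) (hd : (gr M \ G).card = 3)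
    (hS : S ∈ shadowAt M (4 + 2) 4 (Uq M (4 + 2) 4) G) : L1 M 4 G S ≤ 6 / 5 := by
  have hL := L1_le_shadow_mul hG hd (by norm_num) hS
  rw [phiQ_four_div_five] at hL
  norm_num at hL
  exact hL

open scoped Classical in
/-- At `d = 3`, `q = 4`, without coloops of `M|G`: `1 − fS S ≤ 1/6` at every shadow set (the served fraction
is at least `5/6`). -/
theorem one_sub_fS_le_sixth (hG : G ∈ flatsQ M (4 + 1)) (hd : (gr M \ G).card = 3) (hk : kColoops M G = 0)
    (hS : S ∈ shadowAt M (4 + 2) 4 (Uq M (4 + 2) 4) G) : 1 - fS M 4 G S ≤ 1 / 6 := by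
  have h := one_sub_fS_le_of_capS_eq_one (capS_eq_one_of_kColoops_eq_zero hk S) (L1_le_six_fifths hG hd hS)
    (by norm_num)
  norm_num at h
  linarith

open scoped Classical in
/-- At `d = 3`, `q = 4`, without coloops of `M|G`: every loss is at most `1/25`. -/
theorem loss_le_d3_zero (hG : G ∈ flatsQ M (4 + 1)) (hd : (gr M \ G).card = 3) (hk : kColoops M G = 0)
    {B : Finset α} (hB : B ∈ membersIn M (Uq M (4 + 2) 4) G) (hB0 : B ∉ lay0 M 4 G) {z : α}
    (hz : z ∈ G \ clF M B) : loss M 4 G B z ≤ 1 / 25 := by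
  have hS : insert z B ∈ shadowAt M (4 + 2) 4 (Uq M (4 + 2) 4) G :=
    insert_mem_shadowAt (Finset.Subset.refl _) hG hB hz
  have h1 := one_sub_fS_le_sixth hG hd hk hS
  have hreq : req M 4 B ≤ 6 / 25 := by
    have := req_le_of_not_lay0 hG hd (by norm_num) hB hB0
    rw [phiQ_four_div_five] at this
    exact this
  have hcap : 0 ≤ capS M 4 G (insert z B) := by
    rw [capS_eq_one_of_kColoops_eq_zero hk]; exact zero_le_one
  have h0 : 0 ≤ 1 - fS M 4 G (insert z B) := by
    have := fS_le_one hcap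
    linarith
  unfold loss
  calc req M 4 B * (1 - fS M 4 G (insert z B)) ≤ (6 / 25) * (1 / 6) :=
        mul_le_mul hreq h1 h0 (by norm_num)
    _ = 1 / 25 := by norm_num

open scoped Classical in
/-- At `d = 3`, `q = 4`, without coloops of `M|G`: `w₂(B, S) ≤ (2/25)/(|G ∖ cl B| − 1)`. -/
theorem w2_le_d3_zero (hG : G ∈ flatsQ M (4 + 1)) (hd : (gr M \ G).card = 3) (hk : kColoops M G = 0)
    {B : Finset α} (hB : B ∈ ex2 M 4 G S) :
    w2 M 4 G B S ≤ (2 / 25) / (((G \ clF M B).card : ℚ) - 1) := by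
  obtain ⟨hBm, hB0, hBS, hsub, hcard⟩ := mem_ex2_unpack hB
  have hm : 2 ≤ (G \ clF M B).card := hcard ▸ Finset.card_le_card hsub
  have hden : (0 : ℚ) ≤ ((G \ clF M B).card : ℚ) - 1 := by
    have : (2 : ℚ) ≤ ((G \ clF M B).card : ℚ) := by exact_mod_cast hm
    linarith
  have hsum : ∑ z ∈ S \ B, loss M 4 G B z ≤ 2 / 25 := by
    calc ∑ z ∈ S \ B, loss M 4 G B z ≤ ∑ _z ∈ S \ B, (1 : ℚ) / 25 :=
          Finset.sum_le_sum (fun z hz => loss_le_d3_zero hG hd hk hBm hB0 (hsub hz))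
      _ = 2 / 25 := by rw [Finset.sum_const, hcard, nsmul_eq_mul]; norm_num
  unfold w2
  rw [if_pos ⟨hB0, hBS, hsub, hcard⟩]
  exact div_le_div_of_nonneg_right hsum hden

open scoped Classical in
/-- At `d = 3`, `q = 4`, without coloops of `M|G`: `w₂(B, S) ≤ 2/25`. -/
theorem w2_le_two_div_d3_zero (hG : G ∈ flatsQ M (4 + 1)) (hd : (gr M \ G).card = 3) (hk : kColoops M G = 0)
    {B : Finset α} (hB : B ∈ ex2 M 4 G S) : w2 M 4 G B S ≤ 2 / 25 := by
  refine (w2_le_d3_zero hG hd hk hB).trans ?_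
  obtain ⟨-, -, -, hsub, hcard⟩ := mem_ex2_unpack hB
  have hm : 2 ≤ (G \ clF M B).card := hcard ▸ Finset.card_le_card hsub
  have : (1 : ℚ) ≤ ((G \ clF M B).card : ℚ) - 1 := by
    have : (2 : ℚ) ≤ ((G \ clF M B).card : ℚ) := by exact_mod_cast hm
    linarith
  calc (2 / 25 : ℚ) / (((G \ clF M B).card : ℚ) - 1) ≤ (2 / 25) / 1 :=
        div_le_div_of_nonneg_left (by norm_num) (by norm_num) this
    _ = 2 / 25 := by norm_num

open scoped Classical in
/-- At `d = 3`, `q = 4`, without coloops of `M|G`: a thin member (`|G ∖ cl B| ≥ 3`) has `w₂(B, S) ≤ 1/25`. -/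
theorem w2_le_one_div_d3_zero (hG : G ∈ flatsQ M (4 + 1)) (hd : (gr M \ G).card = 3) (hk : kColoops M G = 0)
    {B : Finset α} (hB : B ∈ ex2 M 4 G S) (hm : 3 ≤ (G \ clF M B).card) : w2 M 4 G B S ≤ 1 / 25 := by
  refine (w2_le_d3_zero hG hd hk hB).trans ?_
  have : (2 : ℚ) ≤ ((G \ clF M B).card : ℚ) - 1 := by
    have : (3 : ℚ) ≤ ((G \ clF M B).card : ℚ) := by exact_mod_cast hm
    linarith
  calc (2 / 25 : ℚ) / (((G \ clF M B).card : ℚ) - 1) ≤ (2 / 25) / 2 :=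
        div_le_div_of_nonneg_left (by norm_num) (by norm_num) this
    _ = 1 / 25 := by norm_num

open scoped Classical in
/-- At `d = 3`, `q = 4`, without coloops of `M|G`: `cap₂(S) ≥ 1 − 6·#coloops(S)/25`. -/
theorem cap2_ge_d3_zero (hG : G ∈ flatsQ M (4 + 1)) (hd : (gr M \ G).card = 3) (hk : kColoops M G = 0)
    (S : Finset α) : 1 - ((coloops M S).card : ℚ) * (6 / 25) ≤ cap2 M 4 G S := by
  have hcap1 : capS M 4 G S = 1 := capS_eq_one_of_kColoops_eq_zero hk S
  have h1 := cap2_ge_capS_sub_L1 (M := M) (q := 4) (G := G) (S := S) (by rw [hcap1]; exact zero_le_one)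
  rw [hcap1] at h1
  have h2 := L1_le_coloops_mul hG hd (by norm_num) S
  rw [phiQ_four_div_five] at h2
  linarith

/-- `cap₂(S) ≥ 0` without coloops of `M|G`. -/
theorem cap2_nonneg_d3_zero (hk : kColoops M G = 0) (S : Finset α) : 0 ≤ cap2 M 4 G S :=
  cap2_nonneg (by rw [capS_eq_one_of_kColoops_eq_zero hk]; exact zero_le_one)

open scoped Classical in
/-- **The column bound at `d = 3`, `q = 4`, no coloop of `M|G`, at least two coloops of `S`** (simple `M`):
`load₂(S) ≤ cap₂(S)`. -/
theorem load2_le_cap2_d3_zero_of_two_le (hs : ∀ e ∈ gr M, ∀ f ∈ gr M, e ≠ f → rkN M {e, f} = 2)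
    (hG : G ∈ flatsQ M (4 + 1)) (hd : (gr M \ G).card = 3) (hk : kColoops M G = 0)
    (hS : S ∈ shadowAt M (4 + 2) 4 (Uq M (4 + 2) 4) G) (ha : 2 ≤ (coloops M S).card) :
    load2 M 4 G S ≤ cap2 M 4 G S := by
  have hload := load2_le_card_ex2_mul (M := M) (q := 4) (G := G) (S := S)
    (fun B hB => w2_le_two_div_d3_zero hG hd hk hB)
  have hcap := cap2_ge_d3_zero hG hd hk S
  have hcap0 := cap2_nonneg_d3_zero hk S
  have hex := two_mul_card_ex2_le hG hS
  obtain ⟨a, ha'⟩ : ∃ a, (coloops M S).card = a := ⟨_, rfl⟩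
  rw [ha'] at hex hcap ha
  rcases Nat.lt_or_ge a 5 with h5 | h5
  · interval_cases a
    · -- a = 2: #ex2 ≤ 6, load ≤ 12/25 ≤ 13/25
      have hex6 : (ex2 M 4 G S).card ≤ 6 := by omega
      have hex6' : ((ex2 M 4 G S).card : ℚ) ≤ 6 := by exact_mod_cast hex6
      norm_num at hcap
      nlinarith
    · -- a = 3: #ex2 ≤ 3, load ≤ 6/25 ≤ 7/25
      have hex3 : (ex2 M 4 G S).card ≤ 3 := by omega
      have hex3' : ((ex2 M 4 G S).card : ℚ) ≤ 3 := by exact_mod_cast hex3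
      norm_num at hcap
      nlinarith
    · -- a = 4: no layer-2 weight
      have hempty : ex2 M 4 G S = ∅ := ex2_eq_empty_of_card_coloops_eq hs hG hS ha'
      rw [hempty, Finset.card_empty] at hload
      simp only [Nat.cast_zero, zero_mul] at hload
      exact hload.trans hcap0
  · -- a ≥ 5: no series pair
    have h0 : (4 + 2 - a) * (4 + 1 - a) = 0 := by
      have : 4 + 1 - a = 0 := by omega
      rw [this, mul_zero]
    rw [h0] at hex
    have hcard : (ex2 M 4 G S).card = 0 := by omega
    rw [hcard] at hload
    simp only [Nat.cast_zero, zero_mul] at hload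
    exact hload.trans hcap0

end DThree

end PercRepro.Shadow
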